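import Literature.Algebra.Lie.Sl2Strings
import HarnessLib

/-!
# `sl₂`-triples of operators: the Casimir commutes with the triple; shifted generalised eigenspaces

Topic `Literature/Algebra/Lie` (namespace `Literature.Algebra.Lie.Sl2`, continuing `Sl2Strings`: a triple `(H, E, F)` of
endomorphisms of a vector space `V` and the Casimir operator `casimir H E F = 4 F E + H² + 2 H`). Theorems only (no
definition, no named fact, D-0026). Written for the cell `pub-hodgecm2` (COR-CM), seat `b27`, count-neutral own lane
MT-RANK-SEVEN-TYPEIII; general groundwork for the sequel `Sl2StandardIsotypic` («Casimir `3` ⟹ a sum of standard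
representations»). The `sl₂`-relations are taken as EXPLICIT identities in the associative algebra `End V`,
`H E = E H + 2E`, `H F = F H − 2F`, `E F = F E + H` (no Lie-ring instance on `End V` is used, so that the results apply
verbatim to operators produced inside other constructions).

* §0 `casimir_mul_E` / `casimir_mul_F` / `casimir_mul_H` — the Casimir commutes with `E`, `F`, `H` as an identity in
  `End V` (the versions `commute_casimir_E` … of `Sl2Strings` assume `H` diagonalisable; these do not): e.g.
  `F E E − E F E = −H E`, `H² E − E H² = 4 E H + 4 E`, `H E − E H = 2 E`.
* §1 `apply_mem_maxGenEigenspace_of_rel` — if `H A = A H + c A` then `A` maps the generalised `μ`-eigenspace `V^(μ)`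
  of `H` into `V^(μ + c)` (`E` raises and `F` lowers generalised weights by `2`); disjointness consequences
  (`eq_zero_of_sub_sub_apply_eq_zero`: on `V^(μ)` a product `(H − a)(H − b)` with `a, b ≠ μ` has no kernel); and
  `exists_top_of_ne_bot` — a chain `V^(μ), V^(μ + c), V^(μ + 2c), …` of non-zero generalised eigenspaces terminates
  (`c ≠ 0`, characteristic `0`, finitely many eigenvalues).

## References

* [Humphreys1972] J. E. Humphreys, *Introduction to Lie Algebras and Representation Theory*, GTM 9 (1972), §6.2, §7.1–7.2.
* [Bourbaki2008LieGroups79] N. Bourbaki, *Lie Groups and Lie Algebras, Ch. 7–9*, VIII §1 no. 2–3.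
* [HoffmanKunze1971LinearAlgebra] K. Hoffman, R. Kunze, *Linear Algebra* (1971), §6.8 Thm. 12 (primary decomposition).
-/

noncomputable section

namespace Literature.Algebra.Lie.Sl2

open Module

variable {k : Type*} [Field k]
variable {V : Type*} [AddCommGroup V] [Module k V]
variable {H E F : Module.End k V}

/-! ## §0 The Casimir commutes with the triple (no diagonalisability hypothesis) -/

/-- **The Casimir `4 F E + H² + 2 H` commutes with `E`** (identity in `End V`, no hypothesis on `H`): with
`H E = E H + 2E` and `E F = F E + H` one has `F E E − E F E = −H E`, `H² E − E H² = 4 E H + 4 E`, `H E − E H = 2 E`, and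
`−4 H E + 4 E H + 4 E + 4 E = 0`. [cite: Humphreys1972, §6.2 and §7.2] [cite: Bourbaki2008LieGroups79, VIII §1 no. 3] -/
theorem casimir_mul_E (hHE : H * E = E * H + (2 : k) • E) (hEF : E * F = F * E + H) :
    casimir H E F * E = E * casimir H E F := by
  have h1 : F * E * E - E * (F * E) = -(H * E) := by
    rw [← mul_assoc E F E, hEF, add_mul, mul_assoc]
    abel
  have h2 : H * H * E - E * (H * H) = (4 : k) • (E * H) + (4 : k) • E := by
    rw [mul_assoc, hHE, mul_add, mul_smul_comm, ← mul_assoc, hHE, add_mul, smul_mul_assoc, mul_assoc]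
    module
  rw [← sub_eq_zero]
  have hexp : casimir H E F * E - E * casimir H E F =
      (4 : k) • (F * E * E - E * (F * E)) + (H * H * E - E * (H * H)) + (2 : k) • (H * E - E * H) := by
    simp only [casimir, add_mul, mul_add, smul_mul_assoc, mul_smul_comm, smul_sub]
    abel
  rw [hexp, h1, h2, hHE]
  module

/-- **The Casimir commutes with `F`**: `F E F − F F E = F H`, `H² F − F H² = −4 F H + 4 F`, `H F − F H = −2F`.
[cite: Humphreys1972, §6.2 and §7.2] [cite: Bourbaki2008LieGroups79, VIII §1 no. 3] -/
theorem casimir_mul_F (hHF : H * F = F * H - (2 : k) • F) (hEF : E * F = F * E + H) :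
    casimir H E F * F = F * casimir H E F := by
  have h1 : F * E * F - F * (F * E) = F * H := by
    rw [mul_assoc F E F, hEF, mul_add]
    abel
  have h2 : H * H * F - F * (H * H) = (-4 : k) • (F * H) + (4 : k) • F := by
    rw [mul_assoc, hHF, mul_sub, mul_smul_comm, ← mul_assoc, hHF, sub_mul, smul_mul_assoc, mul_assoc]
    module
  rw [← sub_eq_zero]
  have hexp : casimir H E F * F - F * casimir H E F =
      (4 : k) • (F * E * F - F * (F * E)) + (H * H * F - F * (H * H)) + (2 : k) • (H * F - F * H) := by
    simp only [casimir, add_mul, mul_add, smul_mul_assoc, mul_smul_comm, smul_sub]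
    abel
  rw [hexp, h1, h2, hHF]
  module

/-- **The Casimir commutes with `H`**: `H (F E) = (F H − 2F) E = F (E H + 2E) − 2 F E = (F E) H`.
[cite: Humphreys1972, §6.2 and §7.2] [cite: Bourbaki2008LieGroups79, VIII §1 no. 3] -/
theorem casimir_mul_H (hHE : H * E = E * H + (2 : k) • E) (hHF : H * F = F * H - (2 : k) • F) :
    casimir H E F * H = H * casimir H E F := by
  have h1 : F * E * H = H * (F * E) := by
    rw [← mul_assoc, hHF, sub_mul, smul_mul_assoc, mul_assoc F H E, hHE, mul_add, mul_smul_comm, ← mul_assoc]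
    module
  simp only [casimir, add_mul, mul_add, smul_mul_assoc, mul_smul_comm, h1, mul_assoc]

/-! ## §1 Shifted generalised eigenspaces and chains -/

/-- If `H A = A H + c A` then `(H − (μ + c))ⁿ A = A (H − μ)ⁿ`. [cite: Humphreys1972, §7.1 Lemma] -/
theorem sub_smul_one_pow_mul_of_rel {A : Module.End k V} {c : k} (h : H * A = A * H + c • A) (μ : k) (n : ℕ) :
    (H - (μ + c) • (1 : Module.End k V)) ^ n * A = A * (H - μ • (1 : Module.End k V)) ^ n := by
  induction n with
  | zero => rw [pow_zero, pow_zero, one_mul, mul_one]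
  | succ n ih =>
    have h1 : (H - (μ + c) • (1 : Module.End k V)) * A = A * (H - μ • 1) := by
      rw [sub_mul, smul_mul_assoc, one_mul, h, mul_sub, mul_smul_comm, mul_one, add_smul]
      abel
    rw [pow_succ, mul_assoc, h1, ← mul_assoc, ih, mul_assoc, ← pow_succ]

/-- **If `H A = A H + c A` then `A` maps the generalised `μ`-eigenspace of `H` into the generalised
`(μ + c)`-eigenspace** (`E` raises, `F` lowers generalised weights by `2`). [cite: Humphreys1972, §7.1 Lemma] -/
theorem apply_mem_maxGenEigenspace_of_rel {A : Module.End k V} {c : k} (h : H * A = A * H + c • A) {μ : k} {v : V}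
    (hv : v ∈ H.maxGenEigenspace μ) : A v ∈ H.maxGenEigenspace (μ + c) := by
  rw [Module.End.mem_maxGenEigenspace] at hv ⊢
  obtain ⟨n, hn⟩ := hv
  refine ⟨n, ?_⟩
  rw [← Module.End.mul_apply, sub_smul_one_pow_mul_of_rel h μ n, Module.End.mul_apply, hn, map_zero]

/-- `E` raises generalised weights by `2` (`H E = E H + 2E`). [cite: Humphreys1972, §7.1 Lemma] -/
theorem apply_E_mem_maxGenEigenspace (hHE : H * E = E * H + (2 : k) • E) {μ : k} {v : V}
    (hv : v ∈ H.maxGenEigenspace μ) : E v ∈ H.maxGenEigenspace (μ + 2) :=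
  apply_mem_maxGenEigenspace_of_rel hHE hv

/-- `F` lowers generalised weights by `2` (`H F = F H − 2F`). [cite: Humphreys1972, §7.1 Lemma] -/
theorem apply_F_mem_maxGenEigenspace (hHF : H * F = F * H - (2 : k) • F) {μ : k} {v : V}
    (hv : v ∈ H.maxGenEigenspace μ) : F v ∈ H.maxGenEigenspace (μ + (-2)) := by
  have hHF' : H * F = F * H + (-2 : k) • F := by rw [hHF, neg_smul, sub_eq_add_neg]
  exact apply_mem_maxGenEigenspace_of_rel hHF' hv

/-- `H` preserves its generalised eigenspaces. [folklore] -/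
private theorem apply_H_mem_maxGenEigenspace {μ : k} {v : V} (hv : v ∈ H.maxGenEigenspace μ) :
    H v ∈ H.maxGenEigenspace μ :=
  Module.End.mapsTo_maxGenEigenspace_of_comm (Commute.refl H) μ hv

/-- `H − a` preserves the generalised eigenspaces of `H`. [folklore] -/
private theorem sub_apply_mem_maxGenEigenspace (a : k) {μ : k} {v : V} (hv : v ∈ H.maxGenEigenspace μ) :
    (H - a • (1 : Module.End k V)) v ∈ H.maxGenEigenspace μ := by
  rw [LinearMap.sub_apply, LinearMap.smul_apply, Module.End.one_apply]
  exact Submodule.sub_mem _ (apply_H_mem_maxGenEigenspace hv) (Submodule.smul_mem _ _ hv)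

/-- **A vector of `V^(μ)` killed by `H − a` with `a ≠ μ` vanishes** (generalised eigenspaces for distinct eigenvalues
are disjoint). [cite: HoffmanKunze1971LinearAlgebra, §6.8 Thm. 12 (primary decomposition)] -/
theorem eq_zero_of_mem_maxGenEigenspace_of_sub_apply_eq_zero {a μ : k} (ha : μ ≠ a) {v : V}
    (hv : v ∈ H.maxGenEigenspace μ) (h0 : (H - a • (1 : Module.End k V)) v = 0) : v = 0 := by
  have hva : v ∈ H.maxGenEigenspace a := by
    rw [Module.End.mem_maxGenEigenspace]
    exact ⟨1, by rw [pow_one, h0]⟩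
  have hdisj := Module.End.disjoint_genEigenspace H ha ⊤ ⊤
  rw [disjoint_iff] at hdisj
  have hmem : v ∈ H.maxGenEigenspace μ ⊓ H.maxGenEigenspace a := ⟨hv, hva⟩
  rw [Module.End.maxGenEigenspace, Module.End.maxGenEigenspace] at hmem
  rw [hdisj] at hmem
  exact (Submodule.mem_bot k).1 hmem

/-- **On `V^(μ)` a product `(H − a)(H − b)` with `a, b ≠ μ` has no kernel**: if `(H − a)((H − b) v) = 0` for `v ∈ V^(μ)`,
`μ ≠ a`, `μ ≠ b`, then `v = 0`. [cite: HoffmanKunze1971LinearAlgebra, §6.8 Thm. 12 (primary decomposition)] -/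
theorem eq_zero_of_sub_sub_apply_eq_zero {a b μ : k} (ha : μ ≠ a) (hb : μ ≠ b) {v : V}
    (hv : v ∈ H.maxGenEigenspace μ)
    (h0 : (H - a • (1 : Module.End k V)) ((H - b • (1 : Module.End k V)) v) = 0) : v = 0 := by
  have hw : (H - b • (1 : Module.End k V)) v = 0 :=
    eq_zero_of_mem_maxGenEigenspace_of_sub_apply_eq_zero ha (sub_apply_mem_maxGenEigenspace b hv) h0
  exact eq_zero_of_mem_maxGenEigenspace_of_sub_apply_eq_zero hb hv hw

/-- If `(H − a)((H − μ) v) = 0` for `v ∈ V^(μ)` with `μ ≠ a`, then `H v = μ v`.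
[cite: HoffmanKunze1971LinearAlgebra, §6.8 Thm. 12 (primary decomposition)] -/
theorem apply_eq_smul_of_sub_sub_apply_eq_zero {a μ : k} (ha : μ ≠ a) {v : V} (hv : v ∈ H.maxGenEigenspace μ)
    (h0 : (H - a • (1 : Module.End k V)) ((H - μ • (1 : Module.End k V)) v) = 0) : H v = μ • v := by
  have hw : (H - μ • (1 : Module.End k V)) v = 0 :=
    eq_zero_of_mem_maxGenEigenspace_of_sub_apply_eq_zero ha (sub_apply_mem_maxGenEigenspace μ hv) h0
  rw [LinearMap.sub_apply, LinearMap.smul_apply, Module.End.one_apply, sub_eq_zero] at hw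
  exact hw

section Chains

variable [CharZero k] [FiniteDimensional k V]

omit [CharZero k] [FiniteDimensional k V] in
/-- A non-zero generalised eigenspace means an eigenvalue. [folklore] -/
private theorem hasEigenvalue_of_maxGenEigenspace_ne_bot {μ : k} (h : H.maxGenEigenspace μ ≠ ⊥) :
    H.HasEigenvalue μ :=
  (Module.End.hasUnifEigenvalue_iff_hasUnifEigenvalue_one (f := H) (μ := μ) (k := ⊤) (by simp)).1 h

/-- **Chains of non-zero generalised eigenspaces terminate upwards**: if `V^(μ) ≠ 0` and `c ≠ 0` then for some `j`
`V^(μ + j c) ≠ 0` and `V^(μ + j c + c) = 0` (finitely many eigenvalues; `j ↦ μ + j c` is injective in characteristic `0`).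
[cite: Humphreys1972, §7.1–§7.2 (a maximal weight exists)] -/
theorem exists_top_of_ne_bot {μ c : k} (hc : c ≠ 0) (h : H.maxGenEigenspace μ ≠ ⊥) :
    ∃ j : ℕ, H.maxGenEigenspace (μ + j * c) ≠ ⊥ ∧ H.maxGenEigenspace (μ + j * c + c) = ⊥ := by
  by_contra hne
  push Not at hne
  have hall : ∀ j : ℕ, H.maxGenEigenspace (μ + j * c) ≠ ⊥ := by
    intro j
    induction j with
    | zero => simpa using h
    | succ j ih =>
      have h' := hne j ih
      rwa [Nat.cast_succ, add_mul, one_mul, ← add_assoc]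
  have hinj : Function.Injective fun j : ℕ => μ + j * c := by
    intro i j hij
    have h1 : (i : k) * c = (j : k) * c := add_left_cancel hij
    exact_mod_cast mul_right_cancel₀ hc h1
  have hinf : Set.Infinite {ν : k | H.HasEigenvalue ν} :=
    Set.infinite_of_injective_forall_mem hinj fun j => by exact hasEigenvalue_of_maxGenEigenspace_ne_bot (hall j)
  exact hinf H.finite_hasEigenvalue

end Chains

end Literature.Algebra.Lie.Sl2

end
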